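import Literature.NumberTheory.Transcendental.KontsevichZagier
import Literature.NumberTheory.Transcendental.KZPeriodsProofs
import HarnessLib

/-!
# Periods family — the period ring: discharged facts of `KontsevichZagier` (periods.S05)

Proofs of the period-ring facts (**periods.S05**, and the restated `π ∈ P` of **periods.S06**)
stated in `Literature.NumberTheory.Transcendental.KontsevichZagier`, kept in this sibling file so
that neither the statements file nor its light sibling `KontsevichZagierProofs` has to import the
KZ calculus of `KZPeriodsProofs` (Tarski–Seidenberg, Fubini) on which the ring structure rests.
The statements are the `def … : Prop` facts of `KontsevichZagier`, unchanged.

## Main statements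

* `Literature.NumberTheory.Transcendental.periods_isSubring_holds` — discharge of
  `periods_isSubring` (**periods.S05**): the set `P` of effective Kontsevich–Zagier periods is the
  carrier of a `ℚ`-subalgebra of `ℂ`.
* `Literature.NumberTheory.Transcendental.algebraic_subset_periods_holds` — discharge of
  `algebraic_subset_periods` (**periods.S05**): `ℚ̄ ⊆ P`.
* `Literature.NumberTheory.Transcendental.KontsevichZagier.isPeriod_pi_holds` — discharge of
  `KontsevichZagier.isPeriod_pi` (**periods.S06**): `π ∈ P`.

## Proofs

Kontsevich–Zagier [2001, §1.1] define the set `P` of (effective) periods and record, without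
printed proofs, that it "is obviously countable", that it contains the algebraic numbers, and that
"periods form an algebra, so we get new periods by taking sums and products of known ones"; the
ring axioms, `ℚ ⊆ P`, `ℚ̄ ⊆ P` and `π ∈ P` are proved in the tree for the rational-data
definition `Literature.NumberTheory.Transcendental.IsPeriod` (`KZPeriods`, `KZPeriodsProofs`:
`exists_subring_coe_eq_periods_holds`, `isPeriod_ratCast_holds`, `isPeriod_of_isAlgebraic_holds`,
`KZPeriods.isPeriod_pi_holds`). Here the subring `P` is upgraded to a `Subalgebra ℚ ℂ` by checking
`algebraMap ℚ ℂ r = r • 1 = ↑r ∈ P`, and the remaining two facts are restatements of the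
corresponding `KZPeriods` facts (countability, `periods_countable'_holds`, lives in the sibling
`KontsevichZagierCountableProofs`).

## References

* M. Kontsevich, D. Zagier, *Periods*, in: Mathematics Unlimited — 2001 and Beyond, Springer
  (2001), 771–808, §1.1.
* A. Huber, G. Wüstholz, *Transcendence and Linear Relations of 1-Periods*, Cambridge (2022),
  Prologue and §13.1 (the period algebra; cohomological side, not used here).
-/

noncomputable section

namespace Literature.NumberTheory.Transcendental

/-! ### periods.S05: the period ring -/

/-- Discharge of `periods_isSubring` (**periods.S05**): **the effective Kontsevich–Zagier periods
form a `ℚ`-subalgebra of `ℂ`** — there is `S : Subalgebra ℚ ℂ` with carrier exactly `periods`.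
The subring of `exists_subring_coe_eq_periods_holds` (closure under `+`, `*`, `-`, with `0`, `1`)
contains `algebraMap ℚ ℂ r = ↑r` for every `r : ℚ` by `isPeriod_ratCast_holds`
(`r = ∫_{0 ≤ x₀ ≤ 1} r dx₀`).
[Kontsevich–Zagier 2001, §1.1: "periods form an algebra, so we get new periods by taking sums and
products of known ones"] [cite: KontsevichZagier2001, §1.1] -/
theorem periods_isSubring_holds : periods_isSubring := by
  obtain ⟨P, hP⟩ := exists_subring_coe_eq_periods_holds
  refine ⟨{ P with algebraMap_mem' := fun r => ?_ }, hP⟩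
  have h : IsPeriod (r : ℂ) := isPeriod_ratCast_holds r
  rw [← mem_periods_iff, ← hP] at h
  simpa [Algebra.algebraMap_eq_smul_one] using h

/-- Discharge of `algebraic_subset_periods` (**periods.S05**): `ℚ̄ ⊆ P`, every complex number
algebraic over `ℚ` is an effective period — the `KZPeriods` fact `isPeriod_of_isAlgebraic`, proved
as `isPeriod_of_isAlgebraic_holds` (root isolation for real algebraic numbers; `re z`, `im z` are
algebraic). [Kontsevich–Zagier 2001, §1.1] [cite: KontsevichZagier2001, §1.1] -/
theorem algebraic_subset_periods_holds : algebraic_subset_periods :=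
  fun z hz => isPeriod_of_isAlgebraic_holds z hz

/-! ### periods.S06: `π` -/

/-- Discharge of `KontsevichZagier.isPeriod_pi` (**periods.S06**): `π` is a period — the
`KZPeriods` fact `KZPeriods.isPeriod_pi`, proved as `KZPeriods.isPeriod_pi_holds` via
`π = ∫_{ℝ} dx / (1 + x²)`. [Kontsevich–Zagier 2001, §1.1, eq. (1)]
[cite: KontsevichZagier2001, §1.1 eq. (1)] -/
theorem KontsevichZagier.isPeriod_pi_holds : KontsevichZagier.isPeriod_pi :=
  KZPeriods.isPeriod_pi_holds

end Literature.NumberTheory.Transcendental
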